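/-
Copyright (c) 2026 the pub-hodgecm-mathlib formalisation cell (harness21).  Prover seat hodgecm-mathlib-K2E2-p12 (g5): Track B «K2-LIT», ENGINE E1,
h413 = stmt-HodgeConjecture-24833; DEAL (q10) «R7₃-SCALAR» FILE 1 of the dealer K2E1-plan (g4) (deck #2, spec = K2E1b-plan (g5)'s census memo
`CENSUS-q10-R73-SCALAR-U3.K2E1b-plan-g5.md` 5d5dd905f5646599, adopted 2026-09-04T07:27:35Z).
-/
import Summits.HodgeConjecture.HodgeConjecture.Theorems.K2LiuSiegelIntertwiningScalarGL1   -- ★ O41.6 (K2Liu-p07): `(w−1)ζ_F^S(w)` entire, `L^S(·,ε)` entire & `≠ 0` on `Re = 1`; brings ★ p857988 partial Dedekind zeta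
import HarnessLib

/-!
# K2·E1 — `K2E1IntertwiningScalarContinuationU3`: THE UNRAMIFIED SCALAR `c^S(σ)` OF THE STANDARD INTERTWINING OPERATOR OF `U(J₃) = U(2,1)` —
# Euler product on `Re σ > 2`, continuation to `Re σ > 1` with EXACTLY ONE POLE, simple, at `σ = 2 = 2ρ_H`

Track B ∕ K2-LIT, crux h413 = `stmt-HodgeConjecture-24833`, route of record `HCCMUnconditional`; cell `hodgecm-mathlib`, squad K2, ENGINE E1 (campaign «EIS-RANK-ONE»,
ceiling R7 «continuation of the intertwining operator», now at `N = 3`).  DEAL (q10) «R7₃-SCALAR» (K2E1-plan (g4)), FILE 1: the GL₁ analysis — the `N = 3` twin of ★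
`K2E1IntertwiningScalarContinuationU2` §1–§4 on the road of ★ `K2LiuSiegelIntertwiningScalarGL1`.  THEOREMS ONLY (no `def`, no instance, no notation, no named-fact
hypothesis, no `sorry`; default heartbeats); lane `--supports stmt-HodgeConjecture-24833 --as helper` (count-neutral).

THE OBJECT (census memo of K2E1b-plan (g5), §0–§2).  At `U(J₃)` (`δ_B = H²`, `2ρ_H = 2`) with the flat spherical section `H^σ` (RAW `σ`), the local intertwining scalar at
a finite place `v ∉ S` of `F = L⁺` unramified for everything is, with `ω = ε_{L∕L⁺}` (`ω_v = +1` split, `−1` inert) and `ζ_{L,v} = ∏_{w∣v} ζ_{L_w}`,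
  `c_v(σ) = [ζ_{L,v}(σ−1)∕ζ_{L,v}(σ)]·[L_v(2σ−2, ω)∕L_v(2σ−1, ω)]`
(split: ★ `K2E1GindikinKarpelevichSplitGL3`; inert: ★ `K2E3SphericalCFunctionMacdonald` — the identification of the local integrals with this shape is FILE 2's business,
as at `N = 2`).  In the tree's ★ `partialStandardL` currency over `L⁺` — `P(w; 𝟙) := partialStandardL S (fun _ => {1}) w = ζ^S_F(w)`, `P(w; Ω) := partialStandardL S
(fun v => {ε(ϖ_v)}) w = L^S(w, ε)` for a Hecke character `ε` of `F` (`ζ^S_L = P(·;𝟙)·P(·;Ω)` place by place when `ε = ω`) — the unramified global scalar is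
  **`c^S(σ) = N(σ)∕D(σ)`,   `N(σ) = P(σ−1;𝟙)·P(σ−1;Ω)·P(2σ−2;Ω)`,   `D(σ) = P(σ;𝟙)·P(σ;Ω)·P(2σ−1;Ω)`**
— NOT `ζ^S_{L⁺}(2σ−2)∕ζ^S_{L⁺}(2σ−1)` for the long-root factor (that would plant a spurious pole at `σ = 3∕2`; memo §0).

WHAT IS PROVED — pure GL₁ analysis, for ANY number field `F`, ANY unitary Hecke character `ε` of `F` (for §3–§4: `ε ≠ 1`, trivial on the diagonal positive reals,
unramified off the FINITE set `S`):
* §1 (`Re σ > 2` resp. `> 1`) **`hasProd_num`**, **`hasProd_den`**: `N(σ)`, `D(σ)` as `HasProd`-values, `≠ 0`; **`hasProd_localScalar_three`**: the Euler product over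
  `v ∉ S` of the LOCAL scalars `[(1 − q_v^{−σ})(1 − ε_v q_v^{−σ})(1 − ε_v q_v^{−(2σ−1)})] ∕ [(1 − q_v^{−(σ−1)})(1 − ε_v q_v^{−(σ−1)})(1 − ε_v q_v^{−(2σ−2)})]` converges to `N(σ)∕D(σ)`.
* §2 **`differentiableOn_den`**, **`den_ne_zero`**: the denominator is holomorphic and zero-free on the open half-plane `Re σ > 1` (all three arguments in the Euler region).
* §3 **`exists_entire_sub_two_mul_num`** (`S` finite): `(σ − 2)·N(σ) = A(σ)` on `Re σ > 2` with `A` ENTIRE and `A(2) = ρ_F·E_S(1)·g(1)·g(2) ≠ 0`, where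
  `A(σ) = Z(σ−1)·g(σ−1)·g(2σ−2)`, `Z(w) = (w−1)ζ_F(w)E_S(w)` extended at `1` (★ `differentiable_update_sub_one_mul_zeta`), `g` = the entire continuation of `L^S(·, ε)`
  with `g ≠ 0` on `Re w = 1` (★ `exists_entire_eq_partialL` — Hecke + the prime number theorem for `L(s, ε)`; THE load-bearing input beyond `N = 2`: `L^S(σ−1, ε)` and
  `L^S(2σ−2, ε)` leave the Euler region on `1 < Re σ < 2`, and `g(1) = L^S(1, ε) ≠ 0` makes the residue non-zero).
* §4 MAIN **`exists_differentiableOn_sub_two_mul_scalar`** (`S` finite): `∃ G` HOLOMORPHIC ON `{Re σ > 1}` with **`(σ − 2)·c^S(σ) = G(σ)` for `Re σ > 2`** and **`G(2) ≠ 0`** —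
  `c^S` continues meromorphically to `Re σ > 1` with EXACTLY ONE pole there, SIMPLE, at `σ = 2 = 2ρ_H` (residue `G(2) = ρ_F E_S(1) g(1) g(2) ∕ D(2)`), the `N = 3` instance of
  «the poles of `M(w₀, σ)` in `Re σ > ρ_H` are finitely many, real, simple» [MoeglinWaldspurger1995 IV.1.11]; `c^S` MAY VANISH on `1 < Re σ < 2` (zeros of `ζ_F(σ−1)`,
  `L(2σ−2, ε)` in their critical strips) — irrelevant for (H4-b)₃.
* §5 **CM COROLLARIES `…_cm`**: §1 and §4 for `ε = ε_{L∕L⁺} =` ★ `quadraticHeckeCharCM L`, `F = L⁺` — `ε ≠ 1` (★ `quadraticHeckeCharCM_ne_one`), finite order (★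
  `isFiniteOrder_quadraticHeckeCharCM`) hence unitary and trivial on `ℝ_{>0}` (★ `map_posRealIdele_of_isFiniteOrder`).
HOW E1 USES IT: R7₃ = the constant term of the spherical Eisenstein series on `U(2,1)`: the poles of `M(w₀)H^σ` on `Re σ > 1` at unramified level are those of
`c^S(σ)·c_∞(σ)·∏_{v∈S} c_v(σ)`; §4 pins the unramified part to the single simple pole `σ = 2`.  The archimedean factor, the bad places and the vector-valued continuation stay
ceiling; this file alone pays no socket.
HONEST LABEL: HC_CM is proved only modulo the 7 printed citations (2 remaining named inputs: hLiu418 = `stmt-HodgeConjecture-24832`, h413 = `stmt-HodgeConjecture-24833`) until rung 0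
closes; this file asserts no named fact and closes no socket; count-neutral.

## References
* [MoeglinWaldspurger1995] C. Mœglin, J.-L. Waldspurger, *Spectral Decomposition and Eisenstein Series* (1995): II.1.6–II.1.7, IV.1.11 (rank-one intertwining constants).
* [Harris2007] M. Harris, *Cohomological automorphic forms on unitary groups, II* (Howe volume, 2007): (1.3.4) p. 92.
* [GindikinKarpelevich1962] S. G. Gindikin, F. I. Karpelevič, Dokl. Akad. Nauk SSSR 145 (1962) 252–255 (the local `c`-function).
* [Macdonald1971] I. G. Macdonald, *Spherical functions on a group of p-adic type* (Madras, 1971): Ch. IV–V (the non-reduced rank-one `c`-function).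
* [NeukirchANT1999] J. Neukirch, *Algebraic Number Theory* (1999): Ch. VII (5.2), Cor. (5.11), §8 (Hecke `L`-series).
* [Iwasawa2019] K. Iwasawa, *Hecke's L-functions* (Princeton 1964), SpringerBriefs (2019): Thm. 3.1.
* [Langlands1976] R. P. Langlands, *On the Functional Equations Satisfied by Eisenstein Series*, LNM 544 (1976): Appendix (rank one).
-/

set_option autoImplicit false
set_option linter.dupNamespace false -- the mandated namespace repeats `HodgeConjecture.HodgeConjecture`

noncomputable section

open scoped NNReal
open Filter Topology Complex NumberField IsDedekindDomain
open Literature.NumberTheory.Automorphic Literature.NumberTheory.LFunctions Literature.NumberTheory.GaloisRepresentations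

namespace Summit.HodgeConjecture.HodgeConjecture.Cruxes.H413.K2E1IntertwiningScalarContinuationU3

open Summit.HodgeConjecture.HodgeConjecture.Cruxes.H413.F0P2wPartialDedekindZetaPole
open Summit.HodgeConjecture.HodgeConjecture.Cruxes.HLiu418.K2LiuSiegelIntertwiningScalarGL1
  (differentiable_update_sub_one_mul_zeta exists_entire_eq_partialL norm_valueAtUniformizer_le_one)

variable {F : Type} [Field F] [NumberField F]

/-! ## §0 Bookkeeping: real parts of `σ − 1`, `2σ − 1`, `2σ − 2` -/

/-- `re (σ−1) = re σ − 1`, `re (2σ−1) = 2 re σ − 1`, `re (2σ−2) = 2 re σ − 2`. [folklore] -/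
theorem re_shifts (σ : ℂ) : (σ - 1).re = σ.re - 1 ∧ (2 * σ - 1).re = 2 * σ.re - 1 ∧ (2 * σ - 2).re = 2 * σ.re - 2 := by
  simp [Complex.mul_re]

/-! ## §1 Euler products: the numerator `N(σ)` (`Re σ > 2`), the denominator `D(σ)` (`Re σ > 1`), and the product of the local scalars -/

section GL1

variable {ε : HeckeCharacter F} {S : Set (HeightOneSpectrum (𝓞 F))}

/-- **`N(σ) = ζ_F^S(σ−1)·L^S(σ−1, ε)·L^S(2σ−2, ε)` as an Euler product, `Re σ > 2`**: `∏'_{v∉S}(1 − q_v^{−(σ−1)})⁻¹(1 − ε_v q_v^{−(σ−1)})⁻¹(1 − ε_v q_v^{−(2σ−2)})⁻¹`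
`HasProd`-converges to it and it is `≠ 0` (★ `hasProd_partialDedekindZeta`, ★ `hasProd_partialStandardL_singleton`: all three arguments have `Re > 1`).
[cite: Harris2007, (1.3.4) p. 92] [cite: NeukirchANT1999, Ch. VII (5.2)] -/
theorem hasProd_num (hε : ε.IsUnitary) {σ : ℂ} (hσ : 2 < σ.re) :
    HasProd (fun v : {v : HeightOneSpectrum (𝓞 F) // v ∉ S} =>
        (1 - (v.1.residueCard : ℂ) ^ (-(σ - 1)))⁻¹ * (1 - ε.valueAtUniformizer v.1 * (v.1.residueCard : ℂ) ^ (-(σ - 1)))⁻¹ *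
          (1 - ε.valueAtUniformizer v.1 * (v.1.residueCard : ℂ) ^ (-(2 * σ - 2)))⁻¹)
      (partialStandardL S (fun _ => {1}) (σ - 1) * partialStandardL S (fun v => {ε.valueAtUniformizer v}) (σ - 1) *
        partialStandardL S (fun v => {ε.valueAtUniformizer v}) (2 * σ - 2)) ∧
    partialStandardL S (fun _ => {1}) (σ - 1) * partialStandardL S (fun v => {ε.valueAtUniformizer v}) (σ - 1) *
        partialStandardL S (fun v => {ε.valueAtUniformizer v}) (2 * σ - 2) ≠ 0 := by
  obtain ⟨h1, -, h2⟩ := re_shifts σ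
  have hζ := hasProd_partialDedekindZeta (S := S) (s := σ - 1) (by rw [h1]; linarith)
  have hL := hasProd_partialStandardL_singleton (S := S) (fun v => ε.valueAtUniformizer v)
    (norm_valueAtUniformizer_le_one hε S) (s := σ - 1) (by rw [h1]; linarith)
  have hL' := hasProd_partialStandardL_singleton (S := S) (fun v => ε.valueAtUniformizer v)
    (norm_valueAtUniformizer_le_one hε S) (s := 2 * σ - 2) (by rw [h2]; linarith)
  exact ⟨(hζ.1.mul hL.1).mul hL'.1, mul_ne_zero (mul_ne_zero hζ.2 hL.2) hL'.2⟩

/-- **`D(σ) = ζ_F^S(σ)·L^S(σ, ε)·L^S(2σ−1, ε)` as an Euler product, `Re σ > 1`** (so a fortiori on `Re σ > 2`): `HasProd` and `≠ 0`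
(★ `hasProd_partialDedekindZeta` at `σ`, ★ `hasProd_partialStandardL_singleton` at `σ` and `2σ − 1`). [cite: Harris2007, (1.3.4) p. 92] [cite: NeukirchANT1999, Ch. VII (5.2)] -/
theorem hasProd_den (hε : ε.IsUnitary) {σ : ℂ} (hσ : 1 < σ.re) :
    HasProd (fun v : {v : HeightOneSpectrum (𝓞 F) // v ∉ S} =>
        (1 - (v.1.residueCard : ℂ) ^ (-σ))⁻¹ * (1 - ε.valueAtUniformizer v.1 * (v.1.residueCard : ℂ) ^ (-σ))⁻¹ *
          (1 - ε.valueAtUniformizer v.1 * (v.1.residueCard : ℂ) ^ (-(2 * σ - 1)))⁻¹)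
      (partialStandardL S (fun _ => {1}) σ * partialStandardL S (fun v => {ε.valueAtUniformizer v}) σ *
        partialStandardL S (fun v => {ε.valueAtUniformizer v}) (2 * σ - 1)) ∧
    partialStandardL S (fun _ => {1}) σ * partialStandardL S (fun v => {ε.valueAtUniformizer v}) σ *
        partialStandardL S (fun v => {ε.valueAtUniformizer v}) (2 * σ - 1) ≠ 0 := by
  obtain ⟨-, h2, -⟩ := re_shifts σ
  have hζ := hasProd_partialDedekindZeta (S := S) (s := σ) hσ
  have hL := hasProd_partialStandardL_singleton (S := S) (fun v => ε.valueAtUniformizer v)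
    (norm_valueAtUniformizer_le_one hε S) (s := σ) hσ
  have hL' := hasProd_partialStandardL_singleton (S := S) (fun v => ε.valueAtUniformizer v)
    (norm_valueAtUniformizer_le_one hε S) (s := 2 * σ - 1) (by rw [h2]; linarith)
  exact ⟨(hζ.1.mul hL.1).mul hL'.1, mul_ne_zero (mul_ne_zero hζ.2 hL.2) hL'.2⟩

/-- **THE EULER PRODUCT OF THE LOCAL SCALARS IS `c^S(σ) = N(σ)∕D(σ)`, `Re σ > 2`.**  At an unramified `v ∉ S` the spherical scalar of the standard intertwining
operator of `U(J₃)` is `c_v(σ) = [ζ_{L,v}(σ−1)∕ζ_{L,v}(σ)]·[L_v(2σ−2,ε)∕L_v(2σ−1,ε)]` with `ζ_{L,v}(w)⁻¹ = (1 − q_v^{−w})(1 − ε_v q_v^{−w})`, `L_v(w,ε)⁻¹ = 1 − ε_v q_v^{−w}`, i.e.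
`c_v(σ) = [(1 − q_v^{−σ})(1 − ε_v q_v^{−σ})(1 − ε_v q_v^{−(2σ−1)})] ∕ [(1 − q_v^{−(σ−1)})(1 − ε_v q_v^{−(σ−1)})(1 − ε_v q_v^{−(2σ−2)})]`, and `∏'_{v∉S} c_v(σ)` `HasProd`-converges to
`N(σ)∕D(σ)` (`hasProd_num` times the inverse of `hasProd_den`, `Finset.prod_inv_distrib`). [cite: Harris2007, (1.3.4) p. 92] [cite: Macdonald1971, Ch. V] -/
theorem hasProd_localScalar_three (hε : ε.IsUnitary) {σ : ℂ} (hσ : 2 < σ.re) :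
    HasProd (fun v : {v : HeightOneSpectrum (𝓞 F) // v ∉ S} =>
        ((1 - (v.1.residueCard : ℂ) ^ (-σ)) * (1 - ε.valueAtUniformizer v.1 * (v.1.residueCard : ℂ) ^ (-σ)) *
            (1 - ε.valueAtUniformizer v.1 * (v.1.residueCard : ℂ) ^ (-(2 * σ - 1)))) /
          ((1 - (v.1.residueCard : ℂ) ^ (-(σ - 1))) * (1 - ε.valueAtUniformizer v.1 * (v.1.residueCard : ℂ) ^ (-(σ - 1))) *
            (1 - ε.valueAtUniformizer v.1 * (v.1.residueCard : ℂ) ^ (-(2 * σ - 2)))))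
      ((partialStandardL S (fun _ => {1}) (σ - 1) * partialStandardL S (fun v => {ε.valueAtUniformizer v}) (σ - 1) *
          partialStandardL S (fun v => {ε.valueAtUniformizer v}) (2 * σ - 2)) /
        (partialStandardL S (fun _ => {1}) σ * partialStandardL S (fun v => {ε.valueAtUniformizer v}) σ *
          partialStandardL S (fun v => {ε.valueAtUniformizer v}) (2 * σ - 1))) := by
  obtain ⟨hN, -⟩ := hasProd_num (S := S) hε hσ
  obtain ⟨hD, hD0⟩ := hasProd_den (S := S) hε (show 1 < σ.re by linarith)
  -- invert the `D`-product
  have hDinv : HasProd (fun v : {v : HeightOneSpectrum (𝓞 F) // v ∉ S} =>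
      ((1 - (v.1.residueCard : ℂ) ^ (-σ))⁻¹ * (1 - ε.valueAtUniformizer v.1 * (v.1.residueCard : ℂ) ^ (-σ))⁻¹ *
          (1 - ε.valueAtUniformizer v.1 * (v.1.residueCard : ℂ) ^ (-(2 * σ - 1)))⁻¹)⁻¹)
      (partialStandardL S (fun _ => {1}) σ * partialStandardL S (fun v => {ε.valueAtUniformizer v}) σ *
          partialStandardL S (fun v => {ε.valueAtUniformizer v}) (2 * σ - 1))⁻¹ := by
    unfold HasProd at hD ⊢
    simpa only [Finset.prod_inv_distrib] using hD.inv₀ hD0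
  refine (hN.mul hDinv).congr_fun fun v => ?_
  simp only [mul_inv, inv_inv, div_eq_mul_inv]
  ring

/-! ## §2 The denominator `D(σ)` on the open half-plane `Re σ > 1`: holomorphic and zero-free -/

/-- **`D` is holomorphic on `{Re σ > 1}`** (`ζ_F^S` at `σ`, `L^S(·, ε)` at `σ` and at `2σ − 1` are holomorphic on `Re > 1`: ★ `differentiableOn_partialDedekindZeta`,
★ `differentiableOn_partialStandardL_singleton`, composed with the affine map `σ ↦ 2σ − 1`). [cite: NeukirchANT1999, Ch. VII (5.2)] -/
theorem differentiableOn_den (hε : ε.IsUnitary) :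
    DifferentiableOn ℂ (fun σ : ℂ =>
      partialStandardL S (fun _ => {1}) σ * partialStandardL S (fun v => {ε.valueAtUniformizer v}) σ *
        partialStandardL S (fun v => {ε.valueAtUniformizer v}) (2 * σ - 1))
      {σ : ℂ | 1 < σ.re} := by
  have h1 : DifferentiableOn ℂ (fun σ : ℂ => partialStandardL S (fun _ => ({1} : Multiset ℂ)) σ) {σ : ℂ | 1 < σ.re} :=
    differentiableOn_partialDedekindZeta
  have h2 : DifferentiableOn ℂ (fun σ : ℂ => partialStandardL S (fun v => {ε.valueAtUniformizer v}) σ) {σ : ℂ | 1 < σ.re} :=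
    differentiableOn_partialStandardL_singleton _ (norm_valueAtUniformizer_le_one hε S)
  have h3 : DifferentiableOn ℂ (fun σ : ℂ => partialStandardL S (fun v => {ε.valueAtUniformizer v}) (2 * σ - 1)) {σ : ℂ | 1 < σ.re} :=
    (differentiableOn_partialStandardL_singleton _ (norm_valueAtUniformizer_le_one hε S)).comp
      (((differentiableOn_const _).mul differentiableOn_id).sub (differentiableOn_const _))
      fun σ hσ => by
        have hσ' : 1 < σ.re := hσ
        show 1 < (2 * σ - 1).re
        rw [(re_shifts σ).2.1]; linarith
  exact (h1.mul h2).mul h3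

/-- **`D(σ) ≠ 0` for `Re σ > 1`** (absolutely convergent Euler products). [cite: NeukirchANT1999, Ch. VII (5.2)] -/
theorem den_ne_zero (hε : ε.IsUnitary) {σ : ℂ} (hσ : 1 < σ.re) :
    partialStandardL S (fun _ => {1}) σ * partialStandardL S (fun v => {ε.valueAtUniformizer v}) σ *
        partialStandardL S (fun v => {ε.valueAtUniformizer v}) (2 * σ - 1) ≠ 0 :=
  (hasProd_den (S := S) hε hσ).2

/-! ## §3 The numerator: `(σ − 2)·N(σ)` is the restriction of an ENTIRE function, non-zero at `σ = 2` -/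

/-- **THE NUMERATOR, POLE-FREE, WITH ITS RESIDUE: `(σ − 2)·N(σ) = A(σ)` on `Re σ > 2`, `A` ENTIRE, `A(2) ≠ 0`** (`S` finite, `ε ≠ 1` unitary, trivial on `ℝ_{>0}`,
unramified off `S`).  `A(σ) = Z(σ − 1)·g(σ − 1)·g(2σ − 2)` where `Z(w) = (w − 1)ζ_F(w)E_S(w)` extended by `ρ_F E_S(1)` at `w = 1` is entire (★
`differentiable_update_sub_one_mul_zeta`) and equals `(w − 1)ζ_F^S(w)` for `Re w > 1`, and `g` is the entire continuation of `L^S(·, ε)`, non-vanishing on `Re w = 1` (★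
`exists_entire_eq_partialL`); `σ − 2 = (σ − 1) − 1`.  At `σ = 2`: `A(2) = Z(1)·g(1)·g(2) = ρ_F E_S(1)·L^S(1, ε)·L^S(2, ε) ≠ 0` (★ `residue_mul_thinEulerFactor_ne_zero`; `g(1) ≠ 0` is
Hecke–Landau; `g(2) = L^S(2, ε) ≠ 0` by the Euler product).  So `N(σ)` has a GENUINE simple pole at `σ = 2`.
[cite: NeukirchANT1999, Ch. VII Cor. (5.11), §8] [cite: Iwasawa2019, Thm. 3.1] -/
theorem exists_entire_sub_two_mul_num (hε : ε.IsUnitary) (hA : ∀ t : ℝ≥0ˣ, ε (posRealIdele F t) = 1) (h1 : ε ≠ 1)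
    (hS : S.Finite) (hur : ∀ v ∉ S, ε.IsUnramifiedAt v) :
    ∃ A : ℂ → ℂ, Differentiable ℂ A ∧
      (∀ σ : ℂ, 2 < σ.re →
        (σ - 2) * (partialStandardL S (fun _ => {1}) (σ - 1) * partialStandardL S (fun v => {ε.valueAtUniformizer v}) (σ - 1) *
          partialStandardL S (fun v => {ε.valueAtUniformizer v}) (2 * σ - 2)) = A σ) ∧
      A 2 ≠ 0 := by
  obtain ⟨hZ, hZ_eq⟩ := differentiable_update_sub_one_mul_zeta (F := F) (S := S) hS
  set Z : ℂ → ℂ := Function.update (fun w : ℂ => (w - 1) *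
        (dedekindZetaCont F w * ∏' v : S, (1 - ((v : HeightOneSpectrum (𝓞 F)).residueCard : ℂ) ^ (-w))))
        1 ((dedekindZeta_residue F : ℂ) * ∏' v : S, (1 - ((v : HeightOneSpectrum (𝓞 F)).residueCard : ℂ) ^ (-(1 : ℂ)))) with hZdef
  obtain ⟨g, hg, hg1, hg_eq⟩ := exists_entire_eq_partialL hε hA h1 hS hur
  refine ⟨fun σ => Z (σ - 1) * g (σ - 1) * g (2 * σ - 2), ?_, fun σ hσ => ?_, ?_⟩
  · -- entire
    have hs1 : Differentiable ℂ (fun σ : ℂ => σ - 1) := differentiable_id.sub (differentiable_const _)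
    have hs2 : Differentiable ℂ (fun σ : ℂ => 2 * σ - 2) := ((differentiable_const _).mul differentiable_id).sub (differentiable_const _)
    exact ((hZ.comp hs1).mul (hg.comp hs1)).mul (hg.comp hs2)
  · -- the identity on `Re σ > 2`
    obtain ⟨h1re, -, h2re⟩ := re_shifts σ
    have hw : 1 < (σ - 1).re := by rw [h1re]; linarith
    have hw' : 1 < (2 * σ - 2).re := by rw [h2re]; linarith
    show (σ - 2) * (partialStandardL S (fun _ => {1}) (σ - 1) * partialStandardL S (fun v => {ε.valueAtUniformizer v}) (σ - 1) *
        partialStandardL S (fun v => {ε.valueAtUniformizer v}) (2 * σ - 2)) = Z (σ - 1) * g (σ - 1) * g (2 * σ - 2)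
    rw [hZ_eq (σ - 1) hw, ← hg_eq (σ - 1) hw, ← hg_eq (2 * σ - 2) hw']
    ring
  · -- `A 2 = Z 1 · g 1 · g 2 ≠ 0`
    have e1 : ((2 : ℂ) - 1) = 1 := by norm_num
    have e2 : (2 * (2 : ℂ) - 2) = 2 := by norm_num
    show Z (2 - 1) * g (2 - 1) * g (2 * 2 - 2) ≠ 0
    rw [e1, e2]
    have hZ1 : Z 1 ≠ 0 := by
      rw [hZdef, Function.update_self]
      exact residue_mul_thinEulerFactor_ne_zero (summable_residueCard_rpow_neg_of_finite hS 0) zero_lt_one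
    have hg1' : g 1 ≠ 0 := hg1 1 (by simp)
    have hg2 : g 2 ≠ 0 := by
      rw [← hg_eq 2 (by norm_num)]
      exact (hasProd_partialStandardL_singleton _ (norm_valueAtUniformizer_le_one hε S) (s := 2) (by norm_num)).2
    exact mul_ne_zero (mul_ne_zero hZ1 hg1') hg2

/-! ## §4 MAIN: `c^S(σ) = N(σ)∕D(σ)` continues to `Re σ > 1` with exactly one pole there, simple, at `σ = 2` -/

/-- **R7₃-SCALAR — THE UNRAMIFIED INTERTWINING SCALAR OF `U(J₃) = U(2,1)` ON `Re σ > 1`: ONE SIMPLE POLE, AT `σ = 2 = 2ρ_H`.**  For a number field `F`, a unitary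
Hecke character `ε ≠ 1` of `F` trivial on the diagonal positive reals, and a finite set `S` of finite places off which `ε` is unramified, there is `G` HOLOMORPHIC on
`{Re σ > 1}` with, for `Re σ > 2`,
  `(σ − 2) · [ζ_F^S(σ−1) L^S(σ−1,ε) L^S(2σ−2,ε)] ∕ [ζ_F^S(σ) L^S(σ,ε) L^S(2σ−1,ε)] = G(σ)`,   and   `G(2) ≠ 0`
(`G = A∕D`, §3 over §2).  Hence `c^S(σ) = G(σ)∕(σ − 2)` is the meromorphic continuation of the Euler product of §1 to `Re σ > 1`: holomorphic off `σ = 2`, a GENUINE simple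
pole at `σ = 2` (residue `G(2) = ρ_F E_S(1) L^S(1,ε) L^S(2,ε) ∕ D(2)`), no other singularity on `Re σ > 1` — the `N = 3`, trivial-`K`-type instance of «the poles of `M(w₀, σ)`
in `Re σ > ρ_H` are finitely many, real, simple» [MoeglinWaldspurger1995 IV.1.11], for `ε = ε_{L∕L⁺}` the scalar of the census memo.
[cite: MoeglinWaldspurger1995, IV.1.11] [cite: Langlands1976, Appendix] [cite: Harris2007, (1.3.4) p. 92] [cite: NeukirchANT1999, Ch. VII Cor. (5.11)] [cite: Iwasawa2019, Thm. 3.1] -/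
theorem exists_differentiableOn_sub_two_mul_scalar (hε : ε.IsUnitary) (hA : ∀ t : ℝ≥0ˣ, ε (posRealIdele F t) = 1) (h1 : ε ≠ 1)
    (hS : S.Finite) (hur : ∀ v ∉ S, ε.IsUnramifiedAt v) :
    ∃ G : ℂ → ℂ, DifferentiableOn ℂ G {σ : ℂ | 1 < σ.re} ∧
      (∀ σ : ℂ, 2 < σ.re →
        (σ - 2) *
          ((partialStandardL S (fun _ => {1}) (σ - 1) * partialStandardL S (fun v => {ε.valueAtUniformizer v}) (σ - 1) *
              partialStandardL S (fun v => {ε.valueAtUniformizer v}) (2 * σ - 2)) /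
            (partialStandardL S (fun _ => {1}) σ * partialStandardL S (fun v => {ε.valueAtUniformizer v}) σ *
              partialStandardL S (fun v => {ε.valueAtUniformizer v}) (2 * σ - 1))) = G σ) ∧
      G 2 ≠ 0 := by
  obtain ⟨A, hA', hA_eq, hA2⟩ := exists_entire_sub_two_mul_num hε hA h1 hS hur
  refine ⟨fun σ => A σ /
      (partialStandardL S (fun _ => {1}) σ * partialStandardL S (fun v => {ε.valueAtUniformizer v}) σ *
        partialStandardL S (fun v => {ε.valueAtUniformizer v}) (2 * σ - 1)),
    hA'.differentiableOn.div (differentiableOn_den hε) fun σ hσ => den_ne_zero hε hσ, fun σ hσ => ?_, ?_⟩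
  · show _ = A σ / _
    rw [← hA_eq σ hσ]
    ring
  · show A 2 / _ ≠ 0
    exact div_ne_zero hA2 (den_ne_zero hε (σ := 2) (by norm_num))

end GL1

/-! ## §5 The CM corollaries: `ε = ε_{L∕L⁺}`, `F = L⁺` -/

section CM

variable (L : Type) [Field L] [NumberField L] [IsCMField L]

/-- **THE EULER PRODUCT AT THE CM FRAME** (`Re σ > 2`): for a CM field `L`, `F = L⁺`, `ε = ε_{L∕L⁺} =` ★ `quadraticHeckeCharCM L` (unitary: finite order ★
`isFiniteOrder_quadraticHeckeCharCM`) and any set `S` of finite places of `L⁺`, the product over `v ∉ S` of the local scalars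
`[(1 − q_v^{−σ})(1 − ε_v q_v^{−σ})(1 − ε_v q_v^{−(2σ−1)})] ∕ [(1 − q_v^{−(σ−1)})(1 − ε_v q_v^{−(σ−1)})(1 − ε_v q_v^{−(2σ−2)})]` converges to `c^S(σ) = N(σ)∕D(σ)`; at an inert
`v ∉ S` (`ε_v = −1`) this local scalar is `[ζ_{L_w}(σ−1)∕ζ_{L_w}(σ)]·[(1 + q_v^{−(2σ−1)})∕(1 + q_v^{−(2σ−2)})]` (Macdonald), at a split one (`ε_v = +1`)
`[ζ_v(σ−1)∕ζ_v(σ)]²·ζ_v(2σ−2)∕ζ_v(2σ−1)` (Gindikin–Karpelevich for `GL₃`). [cite: Harris2007, (1.3.4) p. 92] [cite: Macdonald1971, Ch. V] -/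
theorem hasProd_localScalar_three_cm {S : Set (HeightOneSpectrum (𝓞 ↥(maximalRealSubfield L)))} {σ : ℂ} (hσ : 2 < σ.re) :
    HasProd (fun v : {v : HeightOneSpectrum (𝓞 ↥(maximalRealSubfield L)) // v ∉ S} =>
        ((1 - (v.1.residueCard : ℂ) ^ (-σ)) * (1 - (quadraticHeckeCharCM L).valueAtUniformizer v.1 * (v.1.residueCard : ℂ) ^ (-σ)) *
            (1 - (quadraticHeckeCharCM L).valueAtUniformizer v.1 * (v.1.residueCard : ℂ) ^ (-(2 * σ - 1)))) /
          ((1 - (v.1.residueCard : ℂ) ^ (-(σ - 1))) * (1 - (quadraticHeckeCharCM L).valueAtUniformizer v.1 * (v.1.residueCard : ℂ) ^ (-(σ - 1))) *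
            (1 - (quadraticHeckeCharCM L).valueAtUniformizer v.1 * (v.1.residueCard : ℂ) ^ (-(2 * σ - 2)))))
      ((partialStandardL S (fun _ => {1}) (σ - 1) * partialStandardL S (fun v => {(quadraticHeckeCharCM L).valueAtUniformizer v}) (σ - 1) *
          partialStandardL S (fun v => {(quadraticHeckeCharCM L).valueAtUniformizer v}) (2 * σ - 2)) /
        (partialStandardL S (fun _ => {1}) σ * partialStandardL S (fun v => {(quadraticHeckeCharCM L).valueAtUniformizer v}) σ *
          partialStandardL S (fun v => {(quadraticHeckeCharCM L).valueAtUniformizer v}) (2 * σ - 1))) :=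
  hasProd_localScalar_three
    (Literature.RepresentationTheory.HarrisKudlaSweet1996.isFiniteOrder_quadraticHeckeCharCM (L := L)).isUnitary hσ

/-- **R7₃-SCALAR AT THE CM FRAME: the unramified intertwining scalar of `U(2,1)` attached to `L∕L⁺` has exactly one pole on `Re σ > 1`, simple, at `σ = 2`.**  For a CM field
`L`, `F = L⁺`, `ε = ε_{L∕L⁺} =` ★ `quadraticHeckeCharCM L` and a finite set `S` of finite places of `L⁺` off which `ε` is unramified (★ `isUnramifiedAt_quadraticHeckeCharCM_of_isUnramifiedIn`
discharges every `v` unramified in `L∕L⁺`), there is `G` holomorphic on `{Re σ > 1}` with `(σ − 2)·c^S(σ) = G(σ)` for `Re σ > 2` and `G(2) ≠ 0`,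
`c^S(σ) = [ζ_{L⁺}^S(σ−1) L^S(σ−1,ε) L^S(2σ−2,ε)] ∕ [ζ_{L⁺}^S(σ) L^S(σ,ε) L^S(2σ−1,ε)] = [ζ^S_L(σ−1)∕ζ^S_L(σ)]·[L^S(2σ−2,ε)∕L^S(2σ−1,ε)]`; `ε ≠ 1` (★ `quadraticHeckeCharCM_ne_one`), finite order (★
`isFiniteOrder_quadraticHeckeCharCM`) ⇒ unitary, trivial on `ℝ_{>0}` (★ `map_posRealIdele_of_isFiniteOrder`).  This is the unramified scalar of `M(w₀, σ)` on the spherical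
vector of `U(J₃)(𝔸_{L⁺})` (census memo (q10) §0), whose single simple pole at `σ = 2 = 2ρ_H` is the scalar heart of (H4-b)₃.
[cite: MoeglinWaldspurger1995, IV.1.11] [cite: Harris2007, (1.3.4) p. 92] [cite: NeukirchANT1999, Ch. VII Cor. (5.11)] [cite: Iwasawa2019, Thm. 3.1] -/
theorem exists_differentiableOn_sub_two_mul_scalar_cm {S : Set (HeightOneSpectrum (𝓞 ↥(maximalRealSubfield L)))}
    (hS : S.Finite) (hur : ∀ v ∉ S, (quadraticHeckeCharCM L).IsUnramifiedAt v) :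
    ∃ G : ℂ → ℂ, DifferentiableOn ℂ G {σ : ℂ | 1 < σ.re} ∧
      (∀ σ : ℂ, 2 < σ.re →
        (σ - 2) *
          ((partialStandardL S (fun _ => {1}) (σ - 1) * partialStandardL S (fun v => {(quadraticHeckeCharCM L).valueAtUniformizer v}) (σ - 1) *
              partialStandardL S (fun v => {(quadraticHeckeCharCM L).valueAtUniformizer v}) (2 * σ - 2)) /
            (partialStandardL S (fun _ => {1}) σ * partialStandardL S (fun v => {(quadraticHeckeCharCM L).valueAtUniformizer v}) σ *
              partialStandardL S (fun v => {(quadraticHeckeCharCM L).valueAtUniformizer v}) (2 * σ - 1))) = G σ) ∧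
      G 2 ≠ 0 := by
  have hfin : (quadraticHeckeCharCM L).IsFiniteOrder :=
    Literature.RepresentationTheory.HarrisKudlaSweet1996.isFiniteOrder_quadraticHeckeCharCM (L := L)
  exact exists_differentiableOn_sub_two_mul_scalar hfin.isUnitary
    (fun t => HeckeCharacter.map_posRealIdele_of_isFiniteOrder hfin t) (quadraticHeckeCharCM_ne_one L) hS hur

end CM

end Summit.HodgeConjecture.HodgeConjecture.Cruxes.H413.K2E1IntertwiningScalarContinuationU3

end
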